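import Mathlib.RingTheory.Valuation.ValuationSubring
import Mathlib.RingTheory.Valuation.RankOne
import Mathlib.RingTheory.LocalRing.ResidueField.Basic
import Mathlib.RingTheory.AlgebraicIndependent.TranscendenceBasis
import Mathlib.RingTheory.Localization.FractionRing
import Mathlib.RingTheory.Adjoin.FG
import HarnessLib

/-!
# Composite valuations: overrings, residue valuation rings, finite rank, rank one

Topic: `Literature/AlgebraicGeometry/Resolution`. Fully proved valuation-theoretic glue used by the
induction on the rank in Novacoski–Spivakovsky's reduction of local uniformization to rank one
(`RankOneReduction.lean`, `RankOneReductionSteps.lean`). Everything here is folklore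
(Zariski–Samuel II, Ch. VI §§ 3, 4, 10; Bourbaki, *Alg. Comm.* VI §4, §10 no. 3).

## Content

* The **rank** of a valuation ring `O` of `K` is measured by the (linearly ordered) type of its
  overrings `{S : ValuationSubring K // O ≤ S}` (in bijection with `PrimeSpectrum O` by Mathlib's
  `ValuationSubring.primeSpectrumEquiv`); "rank `n`" = `n + 1` overrings.
* `card_overrings_ofPrime_lt` — coarsening at a non-maximal prime drops the rank.
* `residueValuationSubring O O₁ h` — for a coarsening `O ≤ O₁`, the image `O / m_{O₁}` of `O` in
  the residue field of `O₁` is a valuation ring of it (the valuation `ν₂` with `ν = ν₁ ∘ ν₂`);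
  `card_overrings_residue_lt` — its rank is smaller than that of `O` when `O₁ ≠ K`.
* `comapHull` / `card_overrings_comap_le` — restricting a valuation ring along a field embedding
  `L → K` does not increase the rank (every overring of `O ∩ L` extends to an overring of `O`).
* `nonempty_rankOne_of_overrings` — a valuation ring `O ≠ K` whose only overrings are `O` and
  `K` has a rank-one valuation (`Valuation.RankOne`, via `MulArchimedean` value group).
* `finite_overrings_of_fg` — a valuation ring of `K` containing the field `k`, with `K` the
  fraction field of a finitely generated `k`-algebra, has finitely many overrings
  (rank `≤ tr.deg_k K`, Abhyankar's inequality in its weakest form: elements taken from the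
  successive differences of a chain of overrings are algebraically independent over `k`).

## Design choices

Overrings instead of prime ideals or convex subgroups: Mathlib's `ValuationSubring` API
(`ofPrime`, `idealOfLE`, `primeSpectrumEquiv`, `linearOrderOverring`, `mapOfLE`) makes them the
cheapest currency. All declarations live in `namespace Literature.AlgGeom`.
-/

noncomputable section

open IsLocalRing

namespace Literature.AlgebraicGeometry.Resolution

variable {K : Type*} [Field K]

/-! ### Coarsening at a prime -/

/-- The overrings of a coarsening `O.ofPrime p` are overrings of `O`. [folklore] -/
def overringsOfPrimeEmb (O : ValuationSubring K) (p : Ideal O) [p.IsPrime] :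
    {S : ValuationSubring K // O.ofPrime p ≤ S} → {S : ValuationSubring K // O ≤ S} :=
  fun S => ⟨S.1, le_trans (O.le_ofPrime p) S.2⟩

/-- `overringsOfPrimeEmb` is injective. [folklore] -/
theorem overringsOfPrimeEmb_injective (O : ValuationSubring K) (p : Ideal O) [p.IsPrime] :
    Function.Injective (overringsOfPrimeEmb O p) := by
  intro S T h
  simp only [overringsOfPrimeEmb, Subtype.mk.injEq] at h
  exact Subtype.ext h

/-- Coarsening at a non-maximal prime is a proper overring. [folklore] -/
theorem ofPrime_ne_self (O : ValuationSubring K) (p : Ideal O) [p.IsPrime]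
    (hp : p ≠ maximalIdeal O) : O.ofPrime p ≠ O := by
  intro h
  apply hp
  have h1 := O.idealOfLE_ofPrime p
  have h2 : O.idealOfLE (O.ofPrime p) (O.le_ofPrime p) = O.idealOfLE O le_rfl := by
    congr 1
  rw [h1] at h2
  rw [h2]; rfl

/-- Coarsening at a nonzero prime is not the whole field. [folklore] -/
theorem ofPrime_ne_top (O : ValuationSubring K) (p : Ideal O) [p.IsPrime]
    (hp : p ≠ ⊥) : O.ofPrime p ≠ ⊤ := by
  intro h
  apply hp
  have h1 := O.idealOfLE_ofPrime p
  have h2 : O.idealOfLE (O.ofPrime p) (O.le_ofPrime p) = O.idealOfLE ⊤ le_top := by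
    congr 1
  rw [h1] at h2
  rw [h2, ValuationSubring.idealOfLE_top]

/-- Coarsening at a non-maximal prime strictly decreases the number of overrings. [folklore] -/
theorem card_overrings_ofPrime_lt (O : ValuationSubring K) (p : Ideal O) [p.IsPrime]
    (hp : p ≠ maximalIdeal O) [Finite {S : ValuationSubring K // O ≤ S}] :
    Nat.card {S : ValuationSubring K // O.ofPrime p ≤ S} <
      Nat.card {S : ValuationSubring K // O ≤ S} := by
  have hfin : Finite {S : ValuationSubring K // O.ofPrime p ≤ S} :=
    Finite.of_injective _ (overringsOfPrimeEmb_injective O p)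
  have hle := Nat.card_le_card_of_injective _ (overringsOfPrimeEmb_injective O p)
  refine lt_of_le_of_ne hle fun heq => ?_
  have hbij := (overringsOfPrimeEmb_injective O p).bijective_of_nat_card_le heq.ge
  obtain ⟨S, hS⟩ := hbij.2 ⟨O, le_rfl⟩
  simp only [overringsOfPrimeEmb, Subtype.mk.injEq] at hS
  exact ofPrime_ne_self O p hp (le_antisymm (S.2.trans_eq hS) (O.le_ofPrime p))

/-- A coarsening of a finite-rank valuation ring has finite rank. [folklore] -/
instance finite_overrings_ofPrime (O : ValuationSubring K) (p : Ideal O) [p.IsPrime]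
    [Finite {S : ValuationSubring K // O ≤ S}] :
    Finite {S : ValuationSubring K // O.ofPrime p ≤ S} :=
  Finite.of_injective _ (overringsOfPrimeEmb_injective O p)

/-! ### The residue valuation ring of a composite valuation -/

/-- For a coarsening `O ≤ O₁` of valuation rings of `K`, the image of `O` in the residue field
`κ(O₁) = O₁ / m_{O₁}` is a valuation ring of `κ(O₁)`: the valuation ring of `ν₂` in the
decomposition `ν_O = ν_{O₁} ∘ ν₂` (Novacoski–Spivakovsky 2014, §2.1 and Remark 2.4). [folklore] -/
def residueValuationSubring (O O₁ : ValuationSubring K) (h : O ≤ O₁) :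
    ValuationSubring (ResidueField O₁) where
  toSubring := ((residue O₁).comp (O.inclusion O₁ h)).range
  mem_or_inv_mem' x := by
    obtain ⟨y, rfl⟩ := residue_surjective x
    by_cases hy : (y : K) ∈ O
    · exact Or.inl ⟨⟨y, hy⟩, rfl⟩
    · have hy' : (y : K)⁻¹ ∈ O := (O.mem_or_inv_mem _).resolve_left hy
      have hy0 : (y : K) ≠ 0 := by rintro e; exact hy (e ▸ O.zero_mem)
      have hunit : IsUnit y := by
        refine .of_mul_eq_one ⟨(y : K)⁻¹, h hy'⟩ ?_
        ext; simp [hy0]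
      refine Or.inr ⟨⟨(y : K)⁻¹, hy'⟩, ?_⟩
      simp only [RingHom.coe_comp, Function.comp_apply]
      symm
      apply inv_eq_of_mul_eq_one_right
      rw [← map_mul, ← map_one (residue O₁)]
      congr 1
      apply Subtype.ext
      change (y : K) * (y : K)⁻¹ = 1
      exact mul_inv_cancel₀ hy0

/-- Membership in the residue valuation ring (by definition). [folklore] -/
theorem mem_residueValuationSubring_iff (O O₁ : ValuationSubring K) (h : O ≤ O₁)
    (x : ResidueField O₁) :
    x ∈ residueValuationSubring O O₁ h ↔ ∃ a : O, residue O₁ (O.inclusion O₁ h a) = x :=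
  Iff.rfl

/-- The maximal ideal of a coarsening `O₁ ⊇ O` consists of elements of `O`. [folklore] -/
theorem mem_of_mem_maximalIdeal_of_le (O O₁ : ValuationSubring K) (h : O ≤ O₁) (z : O₁)
    (hz : z ∈ maximalIdeal O₁) : (z : K) ∈ O := by
  by_contra hzO
  have hz' : (z : K)⁻¹ ∈ O := (O.mem_or_inv_mem _).resolve_left hzO
  have hz0 : (z : K) ≠ 0 := by rintro e; exact hzO (e ▸ O.zero_mem)
  apply hz
  refine .of_mul_eq_one ⟨(z : K)⁻¹, h hz'⟩ ?_
  ext; simp [hz0]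

/-- `O / m_{O₁}` is the image of exactly `O`: the residue of `y ∈ O₁` lies in it iff `y ∈ O`
(Novacoski–Spivakovsky 2014, Remark 2.4: `ker (O → O_{ν₂}) = m_{ν₁} ∩ O`). [folklore] -/
theorem residue_mem_residueValuationSubring_iff (O O₁ : ValuationSubring K) (h : O ≤ O₁)
    (y : O₁) : residue O₁ y ∈ residueValuationSubring O O₁ h ↔ (y : K) ∈ O := by
  constructor
  · rintro ⟨a, ha⟩
    simp only [RingHom.coe_comp, Function.comp_apply] at ha
    rw [← sub_eq_zero, ← map_sub, IsLocalRing.residue_eq_zero_iff] at ha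
    have hm := mem_of_mem_maximalIdeal_of_le O O₁ h _ ha
    have : (y : K) = (O.inclusion O₁ h a : K) - ((O.inclusion O₁ h a - y : O₁) : K) := by
      push_cast; ring
    rw [this]
    exact O.sub_mem (show ((O.inclusion O₁ h a : O₁) : K) ∈ O from a.2) hm
  · intro hy; exact ⟨⟨y, hy⟩, rfl⟩

/-- An element of a valuation ring whose inverse lies in the ring is a unit. [folklore] -/
theorem isUnit_of_inv_mem (S : ValuationSubring K) {x : K} (hx : x ∈ S) (hxi : x⁻¹ ∈ S)
    (hx0 : x ≠ 0) : IsUnit (⟨x, hx⟩ : S) :=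
  .of_mul_eq_one ⟨x⁻¹, hxi⟩ (Subtype.ext (mul_inv_cancel₀ hx0))

/-- The inverse (in `K`) of a unit of a valuation ring lies in the ring. [folklore] -/
theorem inv_mem_of_isUnit (S : ValuationSubring K) {x : K} (hx : x ∈ S)
    (hu : IsUnit (⟨x, hx⟩ : S)) : x⁻¹ ∈ S := by
  obtain ⟨u, hu⟩ := hu
  have e : x * (((u⁻¹ : Sˣ) : S) : K) = 1 := by
    have := congrArg (fun z : S => (z : K)) u.mul_inv
    simpa [hu] using this
  rw [← eq_inv_of_mul_eq_one_right e]
  exact SetLike.coe_mem _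

/-- Residues of inverse units are inverse. [folklore] -/
theorem residue_mk_inv (O₁ : ValuationSubring K) {x : K} (hx : x ∈ O₁) (hxi : x⁻¹ ∈ O₁)
    (hx0 : x ≠ 0) : residue O₁ ⟨x⁻¹, hxi⟩ = (residue O₁ ⟨x, hx⟩)⁻¹ := by
  symm
  apply inv_eq_of_mul_eq_one_right
  rw [← map_mul, ← map_one (residue O₁)]
  congr 1
  exact Subtype.ext (mul_inv_cancel₀ hx0)

/-- Non-units of `O₁` have residue `0`. [folklore] -/
theorem residue_mk_eq_zero_of_inv_notMem (O₁ : ValuationSubring K) {x : K} (hx : x ∈ O₁)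
    (hxi : x⁻¹ ∉ O₁) : residue O₁ ⟨x, hx⟩ = 0 := by
  rw [residue_eq_zero_iff]
  intro hu
  exact hxi (inv_mem_of_isUnit O₁ hx hu)

/-- Pull-back of an overring `S'` of the residue valuation ring `O / m_{O₁} ⊆ κ(O₁)` to an overring
of `O` inside `O₁`: `{x ∈ O₁ | residue x ∈ S'}`. [folklore] -/
def residueOverringLift (O₁ : ValuationSubring K)
    (S' : ValuationSubring (ResidueField O₁)) : ValuationSubring K where
  toSubring := (S'.toSubring.comap (residue O₁)).map O₁.toSubring.subtype
  mem_or_inv_mem' x := by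
    by_cases hx : x ∈ O₁
    · by_cases hxi : x⁻¹ ∈ O₁
      · rcases eq_or_ne x 0 with rfl | hx0
        · refine Or.inl ⟨⟨0, hx⟩, ?_, rfl⟩
          change residue O₁ ⟨0, _⟩ ∈ S'
          have : (⟨(0 : K), hx⟩ : O₁) = 0 := rfl
          rw [this, map_zero]; exact S'.zero_mem
        rcases S'.mem_or_inv_mem (residue O₁ ⟨x, hx⟩) with h1 | h1
        · exact Or.inl ⟨⟨x, hx⟩, h1, rfl⟩
        · refine Or.inr ⟨⟨x⁻¹, hxi⟩, ?_, rfl⟩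
          change residue O₁ ⟨x⁻¹, hxi⟩ ∈ S'
          rw [residue_mk_inv O₁ hx hxi hx0]; exact h1
      · refine Or.inl ⟨⟨x, hx⟩, ?_, rfl⟩
        change residue O₁ ⟨x, hx⟩ ∈ S'
        rw [residue_mk_eq_zero_of_inv_notMem O₁ hx hxi]; exact S'.zero_mem
    · have hxi : x⁻¹ ∈ O₁ := (O₁.mem_or_inv_mem x).resolve_left hx
      refine Or.inr ⟨⟨x⁻¹, hxi⟩, ?_, rfl⟩
      change residue O₁ ⟨x⁻¹, hxi⟩ ∈ S'
      rw [residue_mk_eq_zero_of_inv_notMem O₁ hxi (by simpa using hx)]; exact S'.zero_mem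

/-- Membership in `residueOverringLift` (by definition). [folklore] -/
theorem mem_residueOverringLift_iff (O₁ : ValuationSubring K)
    (S' : ValuationSubring (ResidueField O₁)) (x : K) :
    x ∈ residueOverringLift O₁ S' ↔ ∃ hx : x ∈ O₁, residue O₁ ⟨x, hx⟩ ∈ S' := by
  constructor
  · rintro ⟨y, hy, rfl⟩
    exact ⟨y.2, hy⟩
  · rintro ⟨hx, h'⟩
    exact ⟨⟨x, hx⟩, h', rfl⟩

/-- The lift of an overring of `O / m_{O₁}` lies inside `O₁`. [folklore] -/
theorem residueOverringLift_le (O₁ : ValuationSubring K)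
    (S' : ValuationSubring (ResidueField O₁)) : residueOverringLift O₁ S' ≤ O₁ := by
  intro x hx
  rw [mem_residueOverringLift_iff] at hx
  exact hx.1

/-- The lift of an overring of `O / m_{O₁}` contains `O`. [folklore] -/
theorem le_residueOverringLift (O O₁ : ValuationSubring K) (h : O ≤ O₁)
    (S' : ValuationSubring (ResidueField O₁)) (hS' : residueValuationSubring O O₁ h ≤ S') :
    O ≤ residueOverringLift O₁ S' := by
  intro x hx
  rw [mem_residueOverringLift_iff]
  exact ⟨h hx, hS' ⟨⟨x, hx⟩, rfl⟩⟩

/-- Overrings of the residue valuation ring `O / m_{O₁}` are pull-backs of overrings of `O`.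
[folklore] -/
def overringsResidueEmb (O O₁ : ValuationSubring K) (h : O ≤ O₁) :
    {S' : ValuationSubring (ResidueField O₁) // residueValuationSubring O O₁ h ≤ S'} →
      {S : ValuationSubring K // O ≤ S} :=
  fun S' => ⟨residueOverringLift O₁ S'.1, le_residueOverringLift O O₁ h S'.1 S'.2⟩

/-- `overringsResidueEmb` is injective (the residue map is onto). [folklore] -/
theorem overringsResidueEmb_injective (O O₁ : ValuationSubring K) (h : O ≤ O₁) :
    Function.Injective (overringsResidueEmb O O₁ h) := by
  intro S T hST
  simp only [overringsResidueEmb, Subtype.mk.injEq] at hST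
  apply Subtype.ext
  ext x
  obtain ⟨y, rfl⟩ := residue_surjective x
  have := SetLike.ext_iff.mp hST (y : K)
  simp only [mem_residueOverringLift_iff, Subtype.coe_eta, SetLike.coe_mem, exists_true_left]
    at this
  exact this

/-- The residue valuation ring of a finite-rank valuation ring has finite rank. [folklore] -/
instance finite_overrings_residue (O O₁ : ValuationSubring K) (h : O ≤ O₁)
    [Finite {S : ValuationSubring K // O ≤ S}] :
    Finite {S' : ValuationSubring (ResidueField O₁) // residueValuationSubring O O₁ h ≤ S'} :=
  Finite.of_injective _ (overringsResidueEmb_injective O O₁ h)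

/-- Passing to the residue valuation ring of a proper coarsening strictly decreases the number of
overrings. [folklore] -/
theorem card_overrings_residue_lt (O O₁ : ValuationSubring K) (h : O ≤ O₁) (hO₁ : O₁ ≠ ⊤)
    [Finite {S : ValuationSubring K // O ≤ S}] :
    Nat.card {S' : ValuationSubring (ResidueField O₁) // residueValuationSubring O O₁ h ≤ S'} <
      Nat.card {S : ValuationSubring K // O ≤ S} := by
  have hle := Nat.card_le_card_of_injective _ (overringsResidueEmb_injective O O₁ h)
  refine lt_of_le_of_ne hle fun heq => ?_
  have hbij := (overringsResidueEmb_injective O O₁ h).bijective_of_nat_card_le heq.ge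
  obtain ⟨S, hS⟩ := hbij.2 ⟨⊤, le_top⟩
  simp only [overringsResidueEmb, Subtype.mk.injEq] at hS
  exact hO₁ (top_le_iff.mp (hS ▸ residueOverringLift_le O₁ S.1))

/-! ### Restriction along a field embedding -/

section comap

variable {L : Type*} [Field L] (O : ValuationSubring K) (f : L →+* K)

/-- Every overring `T'` of the restriction `O.comap f` of `O` to `L` extends to the overring
`{x ∈ K | ∃ t ∈ T', ν_O(x) ≥ ν_O(f t)}` of `O` (its "hull"). [folklore] -/
def comapHull (T' : ValuationSubring L) : ValuationSubring K where
  carrier := {x | ∃ t ∈ T', O.valuation x ≤ O.valuation (f t)}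
  mul_mem' := by
    rintro x y ⟨t, ht, hx⟩ ⟨t', ht', hy⟩
    refine ⟨t * t', mul_mem ht ht', ?_⟩
    rw [map_mul, map_mul, map_mul]
    exact mul_le_mul' hx hy
  one_mem' := ⟨1, T'.one_mem, by simp⟩
  add_mem' := by
    rintro x y ⟨t, ht, hx⟩ ⟨t', ht', hy⟩
    rcases le_total (O.valuation (f t)) (O.valuation (f t')) with hle | hle
    · exact ⟨t', ht', (O.valuation.map_add x y).trans (max_le (hx.trans hle) hy)⟩
    · exact ⟨t, ht, (O.valuation.map_add x y).trans (max_le hx (hy.trans hle))⟩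
  zero_mem' := ⟨0, T'.zero_mem, by simp⟩
  neg_mem' := by
    rintro x ⟨t, ht, hx⟩
    exact ⟨t, ht, by rwa [Valuation.map_neg]⟩
  mem_or_inv_mem' x := by
    rcases O.mem_or_inv_mem x with hx | hx
    · exact Or.inl ⟨1, T'.one_mem, by rw [map_one, map_one]; exact (O.valuation_le_one_iff _).2 hx⟩
    · exact Or.inr ⟨1, T'.one_mem, by rw [map_one, map_one]; exact (O.valuation_le_one_iff _).2 hx⟩

variable {O f} in
/-- Membership in `comapHull` (by definition). [folklore] -/
theorem mem_comapHull_iff (T' : ValuationSubring L) (x : K) :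
    x ∈ comapHull O f T' ↔ ∃ t ∈ T', O.valuation x ≤ O.valuation (f t) := Iff.rfl

/-- The hull of an overring of `O.comap f` contains `O`. [folklore] -/
theorem le_comapHull (T' : ValuationSubring L) : O ≤ comapHull O f T' :=
  fun x hx => ⟨1, T'.one_mem, by rw [map_one, map_one]; exact (O.valuation_le_one_iff _).2 hx⟩

/-- The hull of `T' ⊇ O.comap f` restricts back to `T'`. [folklore] -/
theorem comap_comapHull (T' : ValuationSubring L) (hT' : O.comap f ≤ T') :
    (comapHull O f T').comap f = T' := by
  ext x
  simp only [ValuationSubring.mem_comap, mem_comapHull_iff]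
  constructor
  · rintro ⟨t, ht, hx⟩
    rcases eq_or_ne t 0 with rfl | ht0
    · have : f x = 0 := by simpa using hx
      rw [map_eq_zero] at this
      rw [this]; exact T'.zero_mem
    · have hft : O.valuation (f t) ≠ 0 := by simpa using ht0
      have hq : x / t ∈ O.comap f := by
        rw [ValuationSubring.mem_comap, ← O.valuation_le_one_iff, map_div₀, map_div₀]
        exact div_le_one_of_le₀ hx zero_le
      have : x = x / t * t := by field_simp
      rw [this]
      exact mul_mem (hT' hq) ht
  · intro hx
    exact ⟨x, hx, le_rfl⟩

/-- Overrings of the restriction `O.comap f` embed into overrings of `O`. [folklore] -/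
def overringsComapEmb :
    {T' : ValuationSubring L // O.comap f ≤ T'} → {T : ValuationSubring K // O ≤ T} :=
  fun T' => ⟨comapHull O f T'.1, le_comapHull O f T'.1⟩

/-- `overringsComapEmb` is injective. [folklore] -/
theorem overringsComapEmb_injective : Function.Injective (overringsComapEmb O f) := by
  intro S T hST
  simp only [overringsComapEmb, Subtype.mk.injEq] at hST
  apply Subtype.ext
  rw [← comap_comapHull O f S.1 S.2, ← comap_comapHull O f T.1 T.2, hST]

/-- The restriction of a finite-rank valuation ring has finite rank. [folklore] -/
instance finite_overrings_comap [Finite {S : ValuationSubring K // O ≤ S}] :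
    Finite {T' : ValuationSubring L // O.comap f ≤ T'} :=
  Finite.of_injective _ (overringsComapEmb_injective O f)

/-- Restricting a valuation ring along a field embedding does not increase the number of
overrings (the rank). [folklore] -/
theorem card_overrings_comap_le [Finite {S : ValuationSubring K // O ≤ S}] :
    Nat.card {T' : ValuationSubring L // O.comap f ≤ T'} ≤
      Nat.card {S : ValuationSubring K // O ≤ S} :=
  Nat.card_le_card_of_injective _ (overringsComapEmb_injective O f)

end comap

/-! ### Rank one -/

/-- A valuation ring whose value group is not archimedean has an overring strictly between itself
and the field (i.e. a prime ideal strictly between `0` and the maximal ideal). [folklore] -/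
theorem exists_overring_of_not_mulArchimedean (O : ValuationSubring K)
    (hO : ¬ MulArchimedean O.ValueGroup) :
    ∃ S : ValuationSubring K, O ≤ S ∧ S ≠ O ∧ S ≠ ⊤ := by
  by_contra hcon
  push Not at hcon
  apply hO
  constructor
  intro y x hx
  by_contra hn
  push Not at hn
  -- `x = ν(a)`, `y = ν(b)` with `1 < x`, `x ^ n < y` for all `n`.
  obtain ⟨a, rfl⟩ := O.valuation_surjective x
  obtain ⟨b, rfl⟩ := O.valuation_surjective y
  set v := O.valuation with hv
  have ha0 : a ≠ 0 := by rintro rfl; simp at hx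
  have hb1 : 1 < v b := by simpa using hn 0
  have hb0 : b ≠ 0 := by rintro rfl; simp at hb1
  have hai : a⁻¹ ∈ O := by
    rw [← O.valuation_le_one_iff, map_inv₀]; exact inv_le_one_of_one_le₀ hx.le
  have hbi : b⁻¹ ∈ O := by
    rw [← O.valuation_le_one_iff, map_inv₀]; exact inv_le_one_of_one_le₀ hb1.le
  -- The prime ideal `P = {c ∈ O | ∀ n, ν(c) · ν(a)^n < 1}`.
  let P : Ideal O :=
    { carrier := {c | ∀ n : ℕ, v c * v a ^ n < 1}
      add_mem' := by
        intro c d hc hd n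
        calc v (↑(c + d)) * v a ^ n ≤ max (v c) (v d) * v a ^ n := by
              push_cast; exact mul_le_mul_left (v.map_add _ _) _
          _ < 1 := by
              rcases le_total (v c) (v d) with h | h
              · rw [max_eq_right h]; exact hd n
              · rw [max_eq_left h]; exact hc n
      zero_mem' := by intro n; simp
      smul_mem' := by
        intro o c hc n
        calc v (↑(o • c)) * v a ^ n = v o * (v c * v a ^ n) := by
              simp only [smul_eq_mul]; push_cast; rw [map_mul, mul_assoc]
          _ ≤ 1 * (v c * v a ^ n) := mul_le_mul_left (O.valuation_le_one o) _
          _ < 1 := by rw [one_mul]; exact hc n }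
  have hPprime : P.IsPrime := by
    refine ⟨?_, ?_⟩
    · rw [Ideal.ne_top_iff_one]
      intro h1
      have := h1 0
      simp at this
    · intro c d hcd
      by_contra hcd'
      rw [not_or] at hcd'
      obtain ⟨hc, hd⟩ := hcd'
      change ¬ ∀ n : ℕ, _ at hc hd
      push Not at hc hd
      obtain ⟨n, hn1⟩ := hc
      obtain ⟨m, hm1⟩ := hd
      have := hcd (n + m)
      push_cast at this
      rw [map_mul, pow_add, mul_mul_mul_comm] at this
      exact absurd this (not_lt.mpr (one_le_mul hn1 hm1))
  haveI := hPprime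
  -- `b⁻¹ ∈ P`, `a⁻¹ ∉ P`, so `P ≠ ⊥` and `P ≠ m_O`.
  have hbP : (⟨b⁻¹, hbi⟩ : O) ∈ P := by
    intro n
    change v b⁻¹ * v a ^ n < 1
    rw [map_inv₀, inv_mul_lt_iff₀ (zero_lt_one.trans hb1), mul_one]
    exact hn n
  have haP : (⟨a⁻¹, hai⟩ : O) ∉ P := by
    intro h
    have := h 1
    change v a⁻¹ * v a ^ 1 < 1 at this
    rw [map_inv₀, pow_one, inv_mul_cancel₀ (by simpa using ha0)] at this
    exact lt_irrefl _ this
  have hPbot : P ≠ ⊥ := by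
    intro h
    rw [h] at hbP
    simp only [Ideal.mem_bot, Subtype.ext_iff, ZeroMemClass.coe_zero, inv_eq_zero] at hbP
    exact hb0 hbP
  have hPmax : P ≠ maximalIdeal O := by
    intro h
    apply haP
    rw [h, IsLocalRing.mem_maximalIdeal, mem_nonunits_iff]
    intro hu
    have := inv_mem_of_isUnit O hai hu
    rw [inv_inv, ← O.valuation_le_one_iff] at this
    exact not_lt.mpr this hx
  exact ofPrime_ne_top O P hPbot (hcon (O.ofPrime P) (O.le_ofPrime P) (ofPrime_ne_self O P hPmax))

/-- **Rank one from two overrings.** A valuation ring `O ≠ K` of `K` whose only overrings are `O`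
and `K` carries a rank-one valuation in Mathlib's sense (`Valuation.RankOne`: nontrivial with
value group embedding into `ℝ≥0`). [folklore] -/
theorem nonempty_rankOne_of_overrings (O : ValuationSubring K) (hO : O ≠ ⊤)
    (h2 : ∀ S : ValuationSubring K, O ≤ S → S = O ∨ S = ⊤) :
    Nonempty O.valuation.RankOne := by
  have hnt : O.valuation.IsNontrivial := by
    obtain ⟨x, hxO⟩ : ∃ x, x ∉ O := by
      by_contra h; push Not at h
      exact hO (eq_top_iff.mpr fun x _ => h x)
    refine ⟨x, ?_, ?_⟩
    · have : x ≠ 0 := by rintro rfl; exact hxO O.zero_mem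
      simpa using this
    · intro h1
      exact hxO ((O.valuation_le_one_iff x).mp h1.le)
  rw [Valuation.nonempty_rankOne_iff_mulArchimedean]
  have hM : MulArchimedean O.ValueGroup := by
    by_contra hM
    obtain ⟨S, hOS, hSO, hST⟩ := exists_overring_of_not_mulArchimedean O hM
    rcases h2 S hOS with h | h
    · exact hSO h
    · exact hST h
  exact MulArchimedean.comap MonoidWithZeroHom.ValueGroup₀.embedding.toMonoidHom
    MonoidWithZeroHom.ValueGroup₀.embedding_strictMono

/-! ### Finite rank over a finitely generated field (Abhyankar's inequality, weak form) -/

section rank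

variable {k : Type*} [Field k] [Algebra k K]

open Finset in
/-- Elements chosen in the successive differences of a strictly increasing chain of valuation
rings of `K` containing `k` are algebraically independent over `k` (whence the rank of a
valuation of `K/k` is at most `tr.deg_k K`; Zariski–Samuel II, VI §10, or Bourbaki AC VI §10
no. 3 Cor. 1). [folklore] -/
theorem algebraicIndependent_of_chain {n : ℕ} (S : Fin (n + 1) → ValuationSubring K)
    (hS : StrictMono S) (hk : ∀ c : k, algebraMap k K c ∈ S 0)
    (x : Fin n → K) (hx : ∀ i, x i ∈ S i.succ) (hx' : ∀ i, x i ∉ S i.castSucc) :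
    AlgebraicIndependent k x := by
  classical
  have hx0 : ∀ i, x i ≠ 0 := fun i h0 => hx' i (h0 ▸ (S _).zero_mem)
  -- valuations of the `x i` w.r.t. the members of the chain
  have hone : ∀ i j : Fin n, i < j → (S j.castSucc).valuation (x i) = 1 := by
    intro i j hij
    have hle : S i.succ ≤ S j.castSucc := hS.monotone (Fin.succ_le_castSucc_iff.mpr hij)
    have hle' : S i.castSucc ≤ S j.castSucc := hS.monotone (by
      rw [Fin.castSucc_le_castSucc_iff]; exact hij.le)
    apply le_antisymm ((ValuationSubring.valuation_le_one_iff _ _).mpr (hle (hx i)))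
    have hinv : (x i)⁻¹ ∈ S j.castSucc :=
      hle' (((S i.castSucc).mem_or_inv_mem (x i)).resolve_left (hx' i))
    rw [← ValuationSubring.valuation_le_one_iff, map_inv₀, inv_le_one₀] at hinv
    · exact hinv
    · exact (Valuation.pos_iff _).mpr (hx0 i)
  have hgt : ∀ j : Fin n, 1 < (S j.castSucc).valuation (x j) := by
    intro j
    rw [← not_le, ValuationSubring.valuation_le_one_iff]; exact hx' j
  -- monomials have pairwise distinct values
  let mon : (Fin n →₀ ℕ) → K := fun m => ∏ i, x i ^ m i
  have hmon0 : ∀ m, mon m ≠ 0 := fun m => by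
    simp only [mon]; exact prod_ne_zero_iff.mpr fun i _ => pow_ne_zero _ (hx0 i)
  have hdist : ∀ m m' : Fin n →₀ ℕ, m ≠ m' →
      (S 0).valuation (mon m) ≠ (S 0).valuation (mon m') := by
    intro m m' hmm' heq
    let D : Finset (Fin n) := univ.filter fun i => m i ≠ m' i
    have hD : D.Nonempty := by
      by_contra hD
      rw [not_nonempty_iff_eq_empty, filter_eq_empty_iff] at hD
      exact hmm' (Finsupp.ext fun i => not_not.mp (hD (mem_univ i)))
    set j := D.max' hD with hj
    have hjD : m j ≠ m' j := (mem_filter.mp (D.max'_mem hD)).2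
    have htail : ∀ i, j < i → m i = m' i := by
      intro i hi
      by_contra hne
      exact not_le.mpr hi (D.le_max' i (mem_filter.mpr ⟨mem_univ _, hne⟩))
    -- pass to the valuation `w` of `S j.castSucc`
    set w := (S j.castSucc).valuation with hw
    have h0j : S 0 ≤ S j.castSucc := hS.monotone (Fin.zero_le _)
    have heq' : w (mon m) = w (mon m') := by
      have := congrArg ((S 0).mapOfLE (S j.castSucc) h0j) heq
      rwa [ValuationSubring.mapOfLE_valuation_apply,
        ValuationSubring.mapOfLE_valuation_apply] at this
    have hsplit : ∀ μ : Fin n →₀ ℕ, w (mon μ) =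
        w (x j) ^ μ j * ∏ i ∈ univ.erase j, w (x i) ^ μ i := by
      intro μ
      simp only [mon, map_prod, map_pow]
      exact (mul_prod_erase univ (fun i => w (x i) ^ μ i) (mem_univ j)).symm
    have herase : ∏ i ∈ univ.erase j, w (x i) ^ m i = ∏ i ∈ univ.erase j, w (x i) ^ m' i := by
      refine prod_congr rfl fun i hi => ?_
      rcases lt_or_gt_of_ne (ne_of_mem_erase hi) with h | h
      · rw [hone i j h, one_pow, one_pow]
      · rw [htail i h]
    have hT : (∏ i ∈ univ.erase j, w (x i) ^ m' i) ≠ 0 :=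
      prod_ne_zero_iff.mpr fun i _ => pow_ne_zero _ ((Valuation.ne_zero_iff _).mpr (hx0 i))
    rw [hsplit, hsplit, herase] at heq'
    have hpow := mul_right_cancel₀ hT heq'
    exact hjD ((pow_right_strictMono₀ (hgt j)).injective hpow)
  -- an algebraic relation would be a sum of terms with pairwise distinct values
  rw [algebraicIndependent_iff]
  intro p hp
  by_contra hp0
  have hsupp : p.support.Nonempty := MvPolynomial.support_nonempty.mpr hp0
  have hcoef : ∀ d ∈ p.support,
      (S 0).valuation (algebraMap k K (p.coeff d) * mon d) = (S 0).valuation (mon d) := by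
    intro d hd
    have hc : p.coeff d ≠ 0 := MvPolynomial.mem_support_iff.mp hd
    rw [map_mul]
    convert one_mul _
    apply le_antisymm ((ValuationSubring.valuation_le_one_iff _ _).mpr (hk _))
    have := (ValuationSubring.valuation_le_one_iff _ _).mpr (hk (p.coeff d)⁻¹)
    rw [map_inv₀, map_inv₀, inv_le_one₀] at this
    · exact this
    · rw [Valuation.pos_iff]; simpa using hc
  obtain ⟨d₀, hd₀, hmax⟩ := p.support.exists_max_image (fun d => (S 0).valuation (mon d)) hsupp
  have hsum : (S 0).valuation (MvPolynomial.aeval x p) = (S 0).valuation (mon d₀) := by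
    rw [MvPolynomial.aeval_def, MvPolynomial.eval₂_eq', ← hcoef d₀ hd₀]
    apply Valuation.map_sum_eq_of_lt _ hd₀
    intro d hd
    rw [mem_sdiff, mem_singleton] at hd
    rw [hcoef d hd.1, hcoef d₀ hd₀]
    exact lt_of_le_of_ne (hmax d hd.1) (hdist d d₀ hd.2)
  rw [hp, map_zero] at hsum
  exact (Valuation.ne_zero_iff _).mpr (hmon0 d₀) hsum.symm

/-- **Finite rank.** A valuation ring of `K` containing the field `k`, where `K` is the fraction
field of a finitely generated `k`-algebra, has only finitely many overrings (its rank is at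
most `tr.deg_k K < ∞`). [folklore] -/
theorem finite_overrings_of_fg (O : ValuationSubring K) (hk : ∀ c : k, algebraMap k K c ∈ O)
    (R : Subalgebra k K) (hR : R.FG) [IsFractionRing R K] :
    Finite {S : ValuationSubring K // O ≤ S} := by
  classical
  obtain ⟨t, rfl⟩ := hR
  haveI : Algebra.IsAlgebraic (Algebra.adjoin k (t : Set K)) K :=
    IsLocalization.isAlgebraic K (nonZeroDivisors (Algebra.adjoin k (t : Set K)))
  have htr : Algebra.trdeg k K ≤ (t.card : Cardinal) := by
    simpa using Algebra.IsAlgebraic.trdeg_le_cardinalMk k (t : Set K) (A := K)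
  by_contra hinf
  rw [not_finite_iff_infinite] at hinf
  obtain ⟨s, hs⟩ := Infinite.exists_subset_card_eq {S : ValuationSubring K // O ≤ S} (t.card + 2)
  let e := s.orderIsoOfFin hs
  let S : Fin (t.card + 1 + 1) → ValuationSubring K := fun i => ((e i : s) : {S // O ≤ S}).1
  have hSm : StrictMono S := fun i j hij => by
    have := e.strictMono hij
    exact this
  have hlt : ∀ i : Fin (t.card + 1), S i.castSucc < S i.succ :=
    fun i => hSm (Fin.castSucc_lt_succ)
  choose x hx hx' using fun i => SetLike.exists_of_lt (hlt i)
  have hk0 : ∀ c : k, algebraMap k K c ∈ S 0 := fun c => ((e 0 : s) : {S // O ≤ S}).2 (hk c)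
  have hai := algebraicIndependent_of_chain S hSm hk0 x hx hx'
  have h1 := hai.lift_cardinalMk_le_trdeg
  have h2 := h1.trans (Cardinal.lift_le.mpr htr)
  rw [Cardinal.mk_fin] at h2
  simp only [Cardinal.lift_natCast, Nat.cast_le] at h2
  omega

end rank

end Literature.AlgebraicGeometry.Resolution

end
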